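import Summits.RiemannHypothesis.Statement
import Literature.NumberTheory.LFunctions.JensenPolyaProofs
import Literature.NumberTheory.LFunctions.XiMoments
import Literature.NumberTheory.LFunctions.JensenDegreeDescent
import Literature.Barriers.RiemannHypothesis.JensenPolynomialsRowZeroObstruction
import Literature.Analysis.Complex.JensenLaguerreFlow
import Literature.Analysis.Complex.JensenPolynomialHyperbolicity
import Summits.RiemannHypothesis.RiemannHypothesis.Theorems.Splittings.JointPoly
import Summits.RiemannHypothesis.RiemannHypothesis.Theorems.Splittings.JensenDerivativeLaguerre
import Summits.RiemannHypothesis.RiemannHypothesis.Theorems.Splittings.JenDeflation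
import HarnessLib

/-!
# Splittings / Jensen — the BIRTH / MASK structure of X-4: shift-monotonicity, the corner theorem, thinning
# (cell rh-split, seat rh-split-jen-neg g3; card `cards/SPLIT-jen-neg.md` ADDENDUM 4)

Scratch `HOME/rh-split-jen-neg/g3/SketchG3.lean` sha16 e6ccc93ea857e2fc (zero defs; referee g2 replay 01:09Z: rc 0,
std on `rh_iff_rowZeroLaguerre_and_shiftMono`; «X-4′ RH ⟺ B ∧ Mono hypothesis-free, both binders consumed; corner
theorem re-derived on paper; corner witness checked by hand; labels of record UNCHANGED (X-4 class-(a); A, B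
RH-IMPLIED/OPEN; tautology PASS; UNDECIDED ×2)»); filed verbatim (namespace + provenance tags only) by
rh-split-typer-1 g3 on the lead's GO G8 (2026-08-27T01:01Z).

HONEST LABEL: «SPLITTING SEARCH over kernel-typed RH-EQUIVALENCES; a splitting A ∧ B ⟹ RH is CONDITIONAL
bookkeeping unless A and B are both proved; nothing here bears on the truth of RH.»

X-4 (tree `JensenDerivativeLaguerre`): `RH ⟺ A ∧ B`, A = rows `n ≥ 1` hyperbolic, B = strict Laguerre sign law at the
real critical points of every `J^{d,0}_γ`, `γ = xiTaylorCoeff`.  This scratch (RAW quantified forms, ZERO defs) records: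

* §0 RH-free one-step rules for ANY real sequence `γ`: the SHIFT RULE at the level of hyperbolicity
  (`J^{d+1,n}` hyperbolic ⇒ `J^{d,n+1}` hyperbolic), its iterate (row `0` up to degree `D` ⇒ every cell of depth
  `d + n ≤ D`), the degree-wise `hyperbolic ⇒ B(d)`, and the **MASK LEMMA**: where row `1` is hyperbolic at degree `d`,
  the sign law `B(d+1)` is EQUIVALENT to hyperbolicity of `J^{d+1,0}` — i.e. B is «row 0 masked by row 1».
* §1 **SHIFT-MONOTONICITY COLLAPSES X-4**: `Mono := ∀ d, J^{d,0} hyperbolic → J^{d,1} hyperbolic` gives `B ⟹ RH`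
  (induction on the degree), hence `RH ⟺ B ∧ Mono` with `Mono ⟸ A` — X-4 with a formally WEAKER first conjunct; and the
  **CORNER THEOREM**: `B ∧ ¬RH` forces rows `0` and `1` to break at CONSECUTIVE degrees with row `1` first
  (`δ(1) = δ(0) − 1`): the only place where X-4's conjunct A is load-bearing.
* §2 **THINNING**: `A ∧ (B on any unbounded set of degrees) ⟹ RH` (B's content is cofinal in `d`).
* §3 **CORNER WITNESS** (pure algebra): every sequence starting `1, 1, 1, 2` has `J^{2,0} = (X+1)²` hyperbolic,
  `J^{2,1} = 1 + 2X + 2X²` and `J^{3,0}` not, and `B(3)` VACUOUSLY true — the corner is non-empty as algebra, so `Mono`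
  is a genuine `ξ`-specific conjunct and not a theorem about Jensen polynomials of arbitrary sequences.

Everything is RH-free bookkeeping or conditional; not a claim about RH.
-/

set_option linter.dupNamespace false

noncomputable section

open Polynomial
open Literature.NumberTheory.LFunctions Literature.Barriers.RiemannHypothesis Literature.Analysis.Complex
open Literature.Analysis.Complex.PolyaSchur
open Summit.RiemannHypothesis.RiemannHypothesis.Theorems.Splittings

namespace Summit.RiemannHypothesis.RiemannHypothesis.Theorems.Splittings.JensenShiftMonoCorner

/-! ## §0 RH-free rules for an arbitrary real sequence `γ` -/

-- SHIFT RULE for hyperbolicity (`J^{d+1,n}_γ` hyperbolic ⇒ `J^{d,n+1}_γ` hyperbolic, hence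
-- `δ(n+1) ≥ δ(n) − 1` for the first-failure degrees): this is the LANDED
-- `JenDeflation.splits_jensenPoly_shift_of_succ` (not restated here: dedup).

/-- Iterated shift rule: `J^{d+k,n}_γ` hyperbolic ⇒ `J^{d,n+k}_γ` hyperbolic. [folklore] -/
theorem splits_shift_add_of_splits_add {γ : ℕ → ℝ} (n k : ℕ) :
    ∀ d : ℕ, (jensenPoly γ (d + k) n).Splits → (jensenPoly γ d (n + k)).Splits := by
  induction k with
  | zero => intro d h; simpa using h
  | succ k ih =>
    intro d h
    have h' : (jensenPoly γ ((d + 1) + k) n).Splits := by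
      rwa [show (d + 1) + k = d + (k + 1) by omega]
    have h3 := JenDeflation.splits_jensenPoly_shift_of_succ (ih (d + 1) h')
    rwa [show n + k + 1 = n + (k + 1) by omega] at h3

/-- DEPTH DOMINANCE OF ROW `0`: if `J^{d',0}_γ` is hyperbolic for every `d' ≤ D`, then EVERY cell `(d, n)` of depth
`d + n ≤ D` is hyperbolic.  Consequently no row `n ≥ 1` can fail at information depth `d + n` below the first
failure degree `δ(0)` of row `0`: conjunct A of X-4 never detects before B in depth. [folklore] -/
theorem splits_of_rowZero_upTo {γ : ℕ → ℝ} {D : ℕ} (h : ∀ d ≤ D, (jensenPoly γ d 0).Splits)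
    (d n : ℕ) (hdn : d + n ≤ D) : (jensenPoly γ d n).Splits := by
  have := splits_shift_add_of_splits_add (γ := γ) 0 n d (h (d + n) hdn)
  simpa using this

/-- Degree-wise `hyperbolic ⇒ B(d)`: a hyperbolic `J^{d,0}_γ` of exact degree `d ≥ 1` satisfies the strict Laguerre
sign law at its real critical points off its zeros. [folklore] -/
theorem laguerreAt_of_splits {γ : ℕ → ℝ} {d : ℕ} (hd : 1 ≤ d) (hγ : γ d ≠ 0)
    (h : (jensenPoly γ d 0).Splits) :
    ∀ x : ℝ, (derivative (jensenPoly γ d 0)).eval x = 0 → (jensenPoly γ d 0).eval x ≠ 0 →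
      (jensenPoly γ d 0).eval x * (derivative (derivative (jensenPoly γ d 0))).eval x < 0 := by
  intro x hcrit hne
  have hdeg : (jensenPoly γ d 0).natDegree = d := natDegree_jensenPoly γ d 0 (by rwa [zero_add])
  have hl := JensenDerivativeLaguerre.laguerre_strict_of_splits h (by omega) hne
  rw [hcrit] at hl
  nlinarith [hl]

/-- **MASK LEMMA.**  If row `1` is hyperbolic at degree `d` (and `γ(d+1) ≠ 0`), then at degree `d+1` the sign law
`B(d+1)` is EQUIVALENT to hyperbolicity of `J^{d+1,0}_γ` (⇒ by `JointPoly`, ⇐ by the strict Laguerre inequality).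
So B agrees with «row `0` hyperbolic» at every degree `≤ δ(1)`: B is row `0` MASKED by row `1`. [folklore] -/
theorem laguerreAt_iff_splits_of_rowOne {γ : ℕ → ℝ} {d : ℕ} (hγ : γ (d + 1) ≠ 0)
    (h1 : (jensenPoly γ d 1).Splits) :
    (∀ x : ℝ, (derivative (jensenPoly γ (d + 1) 0)).eval x = 0 → (jensenPoly γ (d + 1) 0).eval x ≠ 0 →
      (jensenPoly γ (d + 1) 0).eval x * (derivative (derivative (jensenPoly γ (d + 1) 0))).eval x < 0)
    ↔ (jensenPoly γ (d + 1) 0).Splits := by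
  constructor
  · intro hB
    refine JointPoly.splits_of_derivative_splits_of_laguerre _ ?_ hB
    rw [JensenLaguerreFlow.derivative_jensenPoly_succ]
    exact (by simpa using h1 : (jensenPoly γ d (0 + 1)).Splits).C_mul _
  · intro h
    exact laguerreAt_of_splits (by omega) hγ h

/-! ## §1 Shift-monotonicity collapses X-4 (for `γ = xiTaylorCoeff`) -/

/-- `Mono ∧ B ⟹ every J^{d,0}_γ hyperbolic` (induction on `d`: row `0` at `d+1` ⇒ (Mono) row `1` at `d+1` ⇒ (MASK
LEMMA with `B(d+2)`) row `0` at `d+2`).  RH-free. [folklore] -/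
theorem rowZero_splits_of_shiftMono_of_rowZeroLaguerre
    (hM : ∀ d : ℕ, (jensenPoly xiTaylorCoeff d 0).Splits → (jensenPoly xiTaylorCoeff d 1).Splits)
    (hB : ∀ d : ℕ, 2 ≤ d → ∀ x : ℝ, (derivative (jensenPoly xiTaylorCoeff d 0)).eval x = 0 →
      (jensenPoly xiTaylorCoeff d 0).eval x ≠ 0 →
      (jensenPoly xiTaylorCoeff d 0).eval x * (derivative (derivative (jensenPoly xiTaylorCoeff d 0))).eval x < 0) :
    ∀ d : ℕ, (jensenPoly xiTaylorCoeff d 0).Splits := by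
  have hstep : ∀ d : ℕ, (jensenPoly xiTaylorCoeff (d + 1) 0).Splits := by
    intro d
    induction d with
    | zero => exact Splits.of_natDegree_le_one ((Literature.NumberTheory.LFunctions.natDegree_jensenPoly_le _ 1 0).trans (by omega))
    | succ d ih =>
      exact (laguerreAt_iff_splits_of_rowOne (γ := xiTaylorCoeff) (d := d + 1)
        (xiTaylorCoeff_pos_holds _).ne' (hM (d + 1) ih)).1 (hB (d + 2) (by omega))
  intro d
  cases d with
  | zero => exact Splits.of_natDegree_le_one ((Literature.NumberTheory.LFunctions.natDegree_jensenPoly_le _ 0 0).trans (by omega))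
  | succ d => exact hstep d

/-- **SHIFT-MONOTONICITY ⟹ (B ⟹ RH).**  Under `Mono` (row `0` hyperbolic at degree `d` ⇒ row `1` hyperbolic at
degree `d`), the conjunct B of X-4 ALONE gives RH.  CONDITIONAL bookkeeping; not a claim about RH.
[cite: GORZPNAS2019, §1] -/
theorem rh_of_shiftMono_of_rowZeroLaguerre
    (hM : ∀ d : ℕ, (jensenPoly xiTaylorCoeff d 0).Splits → (jensenPoly xiTaylorCoeff d 1).Splits)
    (hB : ∀ d : ℕ, 2 ≤ d → ∀ x : ℝ, (derivative (jensenPoly xiTaylorCoeff d 0)).eval x = 0 →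
      (jensenPoly xiTaylorCoeff d 0).eval x ≠ 0 →
      (jensenPoly xiTaylorCoeff d 0).eval x * (derivative (derivative (jensenPoly xiTaylorCoeff d 0))).eval x < 0) :
    _root_.RiemannHypothesis :=
  riemannHypothesis_of_forall_splits_jensenPoly_rowZero (rowZero_splits_of_shiftMono_of_rowZeroLaguerre hM hB)

/-- `A ⟹ Mono` (trivial: A contains all of row `1`). [folklore] -/
theorem shiftMono_of_rowsFromOne (hA : ∀ d n : ℕ, 1 ≤ n → (jensenPoly xiTaylorCoeff d n).Splits) :
    ∀ d : ℕ, (jensenPoly xiTaylorCoeff d 0).Splits → (jensenPoly xiTaylorCoeff d 1).Splits :=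
  fun d _ => hA d 1 le_rfl

/-- `RH ⟹ Mono`. [cite: GORZPNAS2019, §1] -/
theorem shiftMono_of_rh (hRH : _root_.RiemannHypothesis) :
    ∀ d : ℕ, (jensenPoly xiTaylorCoeff d 0).Splits → (jensenPoly xiTaylorCoeff d 1).Splits :=
  fun d _ => (polya_jensen_holds.1 hRH) d 1

/-- **X-4′: `RH ⟺ B ∧ Mono`** — the derivative–Laguerre splitting with its first conjunct weakened from
«all rows `n ≥ 1` hyperbolic» to «row `0` hyperbolic at `d` ⇒ row `1` hyperbolic at `d`».  Kernel, hypothesis-free.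
Both conjuncts RH-implied and open; CONDITIONAL bookkeeping; not a claim about RH. [cite: GORZPNAS2019, §1] -/
theorem rh_iff_rowZeroLaguerre_and_shiftMono :
    _root_.RiemannHypothesis ↔
      (∀ d : ℕ, 2 ≤ d → ∀ x : ℝ, (derivative (jensenPoly xiTaylorCoeff d 0)).eval x = 0 →
        (jensenPoly xiTaylorCoeff d 0).eval x ≠ 0 →
        (jensenPoly xiTaylorCoeff d 0).eval x * (derivative (derivative (jensenPoly xiTaylorCoeff d 0))).eval x < 0) ∧
      (∀ d : ℕ, (jensenPoly xiTaylorCoeff d 0).Splits → (jensenPoly xiTaylorCoeff d 1).Splits) :=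
  ⟨fun h => ⟨JensenDerivativeLaguerre.rowZeroLaguerre_of_rh h, shiftMono_of_rh h⟩,
    fun ⟨hB, hM⟩ => rh_of_shiftMono_of_rowZeroLaguerre hM hB⟩

/-- **CORNER THEOREM.**  If B holds and RH fails, then there is a degree `d₁` with: row `0` hyperbolic at every
degree `≤ d₁`, row `1` hyperbolic at every degree `< d₁`, `J^{d₁,1}` NOT hyperbolic and `J^{d₁+1,0}` NOT hyperbolic —
i.e. the first failures of rows `0` and `1` sit at CONSECUTIVE degrees `δ(1) = d₁ = δ(0) − 1`, row `1` first.
This «corner» is the only configuration in which conjunct A of X-4 is load-bearing.  RH-free; not a claim about RH.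
[cite: GORZPNAS2019, §1] -/
theorem corner_of_rowZeroLaguerre_of_not_rh
    (hB : ∀ d : ℕ, 2 ≤ d → ∀ x : ℝ, (derivative (jensenPoly xiTaylorCoeff d 0)).eval x = 0 →
      (jensenPoly xiTaylorCoeff d 0).eval x ≠ 0 →
      (jensenPoly xiTaylorCoeff d 0).eval x * (derivative (derivative (jensenPoly xiTaylorCoeff d 0))).eval x < 0)
    (hnot : ¬ _root_.RiemannHypothesis) :
    ∃ d₁ : ℕ, (∀ d ≤ d₁, (jensenPoly xiTaylorCoeff d 0).Splits) ∧ (∀ d < d₁, (jensenPoly xiTaylorCoeff d 1).Splits) ∧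
      ¬ (jensenPoly xiTaylorCoeff d₁ 1).Splits ∧ ¬ (jensenPoly xiTaylorCoeff (d₁ + 1) 0).Splits := by
  classical
  have hnM : ∃ d, (jensenPoly xiTaylorCoeff d 0).Splits ∧ ¬ (jensenPoly xiTaylorCoeff d 1).Splits := by
    by_contra hcon
    push Not at hcon
    exact hnot (rh_of_shiftMono_of_rowZeroLaguerre hcon hB)
  have hex : ∃ d, ¬ (jensenPoly xiTaylorCoeff d 1).Splits := by
    obtain ⟨d, _, h⟩ := hnM; exact ⟨d, h⟩
  obtain ⟨d, hd0, hd1⟩ := hnM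
  have hle : Nat.find hex ≤ d := Nat.find_min' hex hd1
  refine ⟨Nat.find hex, fun d' hd' => splits_jensenPoly_of_le (hd'.trans hle) hd0,
    fun d' hd' => ?_, Nat.find_spec hex, fun h => Nat.find_spec hex ?_⟩
  · by_contra h; exact Nat.find_min hex hd' h
  · simpa using JenDeflation.splits_jensenPoly_shift_of_succ h

/-- The corner in words of X-4's own conjuncts: `B ∧ ¬RH ⟹ ¬A` is trivial, but MORE is true — A already fails in
ROW `1`, at the degree just below the first non-hyperbolic row-`0` degree.  Contrapositive bookkeeping of the corner
theorem; not a claim about RH. [cite: GORZPNAS2019, §1] -/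
theorem rowOne_fails_first_of_rowZeroLaguerre_of_not_rh
    (hB : ∀ d : ℕ, 2 ≤ d → ∀ x : ℝ, (derivative (jensenPoly xiTaylorCoeff d 0)).eval x = 0 →
      (jensenPoly xiTaylorCoeff d 0).eval x ≠ 0 →
      (jensenPoly xiTaylorCoeff d 0).eval x * (derivative (derivative (jensenPoly xiTaylorCoeff d 0))).eval x < 0)
    (hnot : ¬ _root_.RiemannHypothesis) :
    ∃ d₁ : ℕ, (jensenPoly xiTaylorCoeff d₁ 0).Splits ∧ ¬ (jensenPoly xiTaylorCoeff d₁ 1).Splits := by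
  obtain ⟨d₁, h0, -, h1, -⟩ := corner_of_rowZeroLaguerre_of_not_rh hB hnot
  exact ⟨d₁, h0 d₁ le_rfl, h1⟩

/-! ## §2 THINNING: B is needed only on an unbounded set of degrees (given A) -/

/-- **THINNING.**  `A ∧ (B(d) for d in ANY unbounded set D) ⟹ RH`: at `d ∈ D`, A gives `(J^{d,0})′ ∝ J^{d-1,1}`
hyperbolic, the MASK LEMMA gives `J^{d,0}` hyperbolic, and degree descent (`splits_jensenPoly_of_le`) spreads this to
every degree below `d`.  So no finite set of instances of B is load-bearing in X-4.  CONDITIONAL bookkeeping.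
[cite: GORZPNAS2019, §1] -/
theorem rh_of_rowsFromOne_of_laguerre_on_unbounded (D : Set ℕ) (hD : ∀ N : ℕ, ∃ d ∈ D, N ≤ d)
    (hA : ∀ d n : ℕ, 1 ≤ n → (jensenPoly xiTaylorCoeff d n).Splits)
    (hBD : ∀ d ∈ D, 2 ≤ d → ∀ x : ℝ, (derivative (jensenPoly xiTaylorCoeff d 0)).eval x = 0 →
      (jensenPoly xiTaylorCoeff d 0).eval x ≠ 0 →
      (jensenPoly xiTaylorCoeff d 0).eval x * (derivative (derivative (jensenPoly xiTaylorCoeff d 0))).eval x < 0) :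
    _root_.RiemannHypothesis := by
  apply riemannHypothesis_of_forall_splits_jensenPoly_rowZero
  intro d
  obtain ⟨e, heD, hle⟩ := hD (d + 2)
  obtain ⟨e', rfl⟩ : ∃ e', e = e' + 1 := ⟨e - 1, by omega⟩
  have hsp : (jensenPoly xiTaylorCoeff (e' + 1) 0).Splits :=
    (laguerreAt_iff_splits_of_rowOne (γ := xiTaylorCoeff) (xiTaylorCoeff_pos_holds _).ne'
      (hA e' 1 le_rfl)).1 (hBD (e' + 1) heD (by omega))
  exact splits_jensenPoly_of_le (by omega) hsp

/-! ## §3 CORNER WITNESS: the corner is non-empty as pure algebra -/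

/-- For EVERY real sequence beginning `γ = (1, 1, 1, 2, …)`: `J^{2,0}_γ = (X + 1)²` is hyperbolic (a DOUBLE root — the
collision), `J^{2,1}_γ = 1 + 2X + 2X²` is not, hence `J^{3,0}_γ` is not (shift rule), and the sign law `B(3)` holds
VACUOUSLY because `(J^{3,0}_γ)′ = 3·J^{2,1}_γ` has no real zero: rows `0` and `1` first fail at the consecutive
degrees `δ(0) = 3`, `δ(1) = 2`, B is BLIND at `d = 3` and only A (row `1`) detects.  So `Mono` is not a theorem about
Jensen polynomials of arbitrary (even positive) sequences.  (This witness violates the Turán inequality at `n = 2`: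
`γ(2)² = 1 < 2 = γ(1)γ(3)`; for `ξ` the Turán inequalities hold and all cells with `d ≤ 10^10` are certified hyperbolic,
so a corner for `ξ`, if any, lives at `d > 10^10`.)  Pure algebra; not a claim about RH. [folklore] -/
theorem corner_witness (γ : ℕ → ℝ) (h0 : γ 0 = 1) (h1 : γ 1 = 1) (h2 : γ 2 = 1) (h3 : γ 3 = 2) :
    (jensenPoly γ 2 0).Splits ∧ ¬ (jensenPoly γ 2 1).Splits ∧ ¬ (jensenPoly γ 3 0).Splits ∧
    (∀ x : ℝ, (derivative (jensenPoly γ 3 0)).eval x = 0 → (jensenPoly γ 3 0).eval x ≠ 0 →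
      (jensenPoly γ 3 0).eval x * (derivative (derivative (jensenPoly γ 3 0))).eval x < 0) := by
  -- explicit forms
  have e20 : jensenPoly γ 2 0 = (X + C 1) ^ 2 := by
    simp only [jensenPoly, Finset.sum_range_succ, Finset.sum_range_zero, zero_add, h0, h1, h2,
      Nat.choose_zero_right, Nat.choose_one_right, Nat.choose_self, Nat.cast_one, Nat.cast_ofNat,
      mul_one, one_mul, pow_zero, pow_one, map_one]
    have : (C (2 : ℝ) : ℝ[X]) = 2 := rfl
    rw [this]; ring
  have e21 : ∀ x : ℝ, (jensenPoly γ 2 1).eval x = 1 + 2 * x + 2 * x ^ 2 := by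
    intro x
    simp only [jensenPoly, Finset.sum_range_succ, Finset.sum_range_zero, zero_add, h1, h2, h3,
      Nat.choose_zero_right, Nat.choose_one_right, Nat.choose_self, Nat.cast_one, Nat.cast_ofNat,
      eval_add, eval_mul, eval_C, eval_pow, eval_X, show (1 : ℕ) + 1 = 2 by rfl, show (1 : ℕ) + 2 = 3 by rfl]
    ring
  have hsp20 : (jensenPoly γ 2 0).Splits := by rw [e20]; exact (Splits.X_add_C _).pow 2
  have hns21 : ¬ (jensenPoly γ 2 1).Splits := by
    intro hs
    have hdeg : (jensenPoly γ 2 1).natDegree = 2 := natDegree_jensenPoly γ 2 1 (by rw [h3]; norm_num)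
    have hdeg' : (jensenPoly γ 2 1).degree ≠ 0 := by
      rw [degree_eq_natDegree (by intro h; rw [h, natDegree_zero] at hdeg; exact absurd hdeg (by norm_num)), hdeg]
      exact_mod_cast (show (2 : ℕ) ≠ 0 by norm_num)
    obtain ⟨a, ha⟩ := hs.exists_eval_eq_zero hdeg'
    rw [e21] at ha
    nlinarith [sq_nonneg (2 * a + 1)]
  have hns30 : ¬ (jensenPoly γ 3 0).Splits := fun h => hns21 (by simpa using JenDeflation.splits_jensenPoly_shift_of_succ h)
  refine ⟨hsp20, hns21, hns30, fun x hcrit _ => ?_⟩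
  -- B(3) is vacuous: (J^{3,0})′ = 3·J^{2,1} has no real zero
  exfalso
  rw [show (3 : ℕ) = 2 + 1 by rfl, JensenLaguerreFlow.derivative_jensenPoly_succ, eval_mul, eval_C] at hcrit
  have h21x := e21 x
  rw [show (0 : ℕ) + 1 = 1 by rfl] at hcrit
  rw [h21x] at hcrit
  nlinarith [sq_nonneg (2 * x + 1)]

end Summit.RiemannHypothesis.RiemannHypothesis.Theorems.Splittings.JensenShiftMonoCorner
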